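import Summits.CriticalPhenomena.PercolationContinuityZ3.Theorems.PercNearOneGluingAdditiveGluingSigmaRecursion
import Summits.CriticalPhenomena.PercolationContinuityZ3.Theorems.PercNearOneGluingAdditiveGluingSigmaGeometry
import Summits.CriticalPhenomena.PercolationContinuityZ3.Theorems.PercNearOneGluingAdditiveGluingSigmaLaw
import HarnessLib

/-! # Crux `PercNearOneGluing.AdditiveGluing` (stmt-CriticalPhenomena-4576), line `peel` (skeleton v7, whole-block
# route), stub `stub_wholeBlockDesignated_c5` — the whole-block σ-identity D (designated two-point function)

Support file (`--supports stmt-CriticalPhenomena-4576`); no definitions, no named facts.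

`μ_{u/S} = prodBernoulli (u/S)` is bond percolation on `Fin n` with the whole block `S` glued
(`(u/S) e = 1` on the non-loop pairs inside `S`, `= u e` otherwise), `d, b ∉ S`.  Partition the two-point event
`d ↔ b` by the layer `N` of `S` (the outside vertices joined to `S` by an open pair; the layer event
`L_N = {ω | ∀ y, y ∈ N ↔ (y ∉ S ∧ ∃ o ∈ S, s(o, y) ∈ ω)}` of `stub_sigmaLaw` with `O = S`):
`μ_{u/S}(d ↔ b) = Σ_N μ_{u/S}(L_N) · μ_{q_N}(d ↔ b)`, where `q_N` is `u` with every star of `S` killed and the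
pairs inside `N` glued.  Proof: `sigmaRec_partition` (partition by the layer); on `L_N` and the conull clique
event `K = {all non-loop pairs inside S open}` (`sigmaRec_conull`, weight `1`), `d ↔ b` in `ω` iff `d ↔ b` in the
glued off-block configuration `Ψ_N ω` (`stub_sigmaGeometry`, part 2, `O = S`), so the two events may be swapped
inside `L_N` (`sigmaRec_inter_congr`); then factor (`stub_sigmaLaw` with `O = S`, the law of `Ψ_N` on `L_N`).
[cite: KozmaNitzan2024, §3.2 pp. 13–14 (the `σ_B`-decomposition)]
-/

namespace Summit.CriticalPhenomena.PercolationContinuityZ3.Theorems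

open MeasureTheory Set
open Literature.Probability.LatticeModels (prodBernoulli)
open Literature.Probability.Percolation (BondConfig openConn openGraph)
open scoped BigOperators Classical

noncomputable section

section WholeBlockDesignated

variable {n : ℕ}

/-- **The clique event of the glued block is conull.**  Under the glued weighting `u/S` (weight `1` on every
non-loop pair inside `S`), almost surely all non-loop pairs inside `S` are open (`sigmaRec_conull`).
[cite: KozmaNitzan2024, §3.1 Remark p. 5 (gluing)] -/
theorem wholeD_clique_conull (u : Sym2 (Fin n) → unitInterval) (S : Finset (Fin n)) :
    prodBernoulli (fun e : Sym2 (Fin n) => if (∀ y ∈ e, y ∈ S) ∧ ¬ e.IsDiag then 1 else u e)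
      {ω : BondConfig (Fin n) | ∀ o ∈ S, ∀ o' ∈ S, o ≠ o' → s(o, o') ∈ ω}ᶜ = 0 := by
  refine sigmaRec_conull _ _ fun ω hω => ?_
  simp only [Set.mem_setOf_eq] at hω
  push Not at hω
  obtain ⟨o, ho, o', ho', hne, hnot⟩ := hω
  refine ⟨s(o, o'), ?_, hnot⟩
  show (if (∀ y ∈ s(o, o'), y ∈ S) ∧ ¬ (s(o, o')).IsDiag then (1 : unitInterval)
    else u s(o, o')) = 1
  rw [if_pos]
  refine ⟨fun y hy => ?_, fun hd => hne (Sym2.mk_isDiag_iff.1 hd)⟩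
  rcases Sym2.mem_iff.1 hy with rfl | rfl
  · exact ho
  · exact ho'

/-- **One layer of identity D.**  For `d, b ∉ S` and a layer value `N`,
`μ_{u/S}(L_N ∩ {d ↔ b}) = μ_{u/S}(L_N ∩ Ψ_N⁻¹{d ↔ b})`: on `L_N` and the conull clique event, `d ↔ b` in `ω`
iff `d ↔ b` in `Ψ_N ω = {e ∈ ω | e avoids S} ∪ {non-loop pairs inside N}` (`stub_sigmaGeometry`, part 2).
[cite: KozmaNitzan2024, §3.2 p. 14] -/
theorem wholeD_layer_congr (u : Sym2 (Fin n) → unitInterval) (S N : Finset (Fin n)) (d b : Fin n)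
    (hdS : d ∉ S) (hbS : b ∉ S) :
    (prodBernoulli (fun e : Sym2 (Fin n) => if (∀ y ∈ e, y ∈ S) ∧ ¬ e.IsDiag then 1 else u e)).real
        ({ω : BondConfig (Fin n) | ∀ y : Fin n, y ∈ N ↔ (y ∉ S ∧ ∃ o ∈ S, s(o, y) ∈ ω)} ∩ openConn d b) =
      (prodBernoulli (fun e : Sym2 (Fin n) => if (∀ y ∈ e, y ∈ S) ∧ ¬ e.IsDiag then 1 else u e)).real
        ({ω : BondConfig (Fin n) | ∀ y : Fin n, y ∈ N ↔ (y ∉ S ∧ ∃ o ∈ S, s(o, y) ∈ ω)} ∩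
          {ω : BondConfig (Fin n) |
            ({e | e ∈ ω ∧ ∀ y ∈ e, y ∉ S} ∪ {e | (∀ y ∈ e, y ∈ N) ∧ ¬ e.IsDiag} : BondConfig (Fin n)) ∈
              openConn d b}) := by
  refine sigmaRec_inter_congr _ (wholeD_clique_conull u S) fun ω hL hK => ?_
  exact (stub_sigmaGeometry n S N ω hL hK).2 d b hdS hbS

end WholeBlockDesignated

/-- **σ-identity D (whole block, designated two-point function)** — registered stub `stub_wholeBlockDesignated_c5`
of crux stmt-CriticalPhenomena-4576 (line `peel`, skeleton v7, whole-block route): with the whole block `S` glued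
and `d, b ∉ S`, the law of total probability over the layer `N` of `S`,
`μ_{u/S}(d ↔ b) = Σ_N μ_{u/S}(layer of S = N) · μ_{q_N}(d ↔ b)` with `q_N` = `u` with every star of `S` killed and
`N` glued.  Partition by the layer (`sigmaRec_partition`), swap `{d ↔ b}` for `Ψ_N⁻¹{d ↔ b}` inside each layer
(`wholeD_layer_congr`: geometry part 2 on the conull clique event), factor (`stub_sigmaLaw` with `O = S`).
[cite: KozmaNitzan2024, §3.2 pp. 13–14 (the `σ_B`-decomposition)] -/
theorem stub_wholeBlockDesignated_c5 :
    ∀ (n : ℕ) (u : Sym2 (Fin n) → unitInterval) (S : Finset (Fin n)) (d b : Fin n), d ∉ S → b ∉ S →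
      (prodBernoulli (fun e : Sym2 (Fin n) => if (∀ y ∈ e, y ∈ S) ∧ ¬ e.IsDiag then 1 else u e)).real (openConn d b)
        = ∑ N : Finset (Fin n), (prodBernoulli (fun e : Sym2 (Fin n) => if (∀ y ∈ e, y ∈ S) ∧ ¬ e.IsDiag then 1 else u e)).real {ω : BondConfig (Fin n) | ∀ y : Fin n, y ∈ N ↔ (y ∉ S ∧ ∃ o ∈ S, s(o, y) ∈ ω)}
            * (prodBernoulli (fun e : Sym2 (Fin n) => if (∀ y ∈ e, y ∈ N) ∧ ¬ e.IsDiag then 1 else if (∃ y ∈ e, y ∈ S) then 0 else u e)).real (openConn d b) := by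
  intro n u S d b hdS hbS
  rw [sigmaRec_partition (fun e : Sym2 (Fin n) => if (∀ y ∈ e, y ∈ S) ∧ ¬ e.IsDiag then 1 else u e) S
    (openConn d b)]
  refine Finset.sum_congr rfl fun N _ => ?_
  rw [← stub_sigmaLaw n u S N (openConn d b)]
  exact wholeD_layer_congr u S N d b hdS hbS

end

end Summit.CriticalPhenomena.PercolationContinuityZ3.Theorems
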